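import Summits.QuantumFields.YangMills.Theorems.BalabanUVNodesN06StepL2AtPinsPhysR
import Summits.QuantumFields.YangMills.Theorems.BalabanUVNodesN06StepL2AtPinsPhys
import Literature.MathematicalPhysics.QuantumFieldTheory.Balaban1983to89.B9BackgroundsKLevelV1R

/-!
# CASCADE-K PIECE K2 (director-ym №383) — THE SITE-TRANSPORTER-PARAMETRIC RE-PRESS of `N06StepL2AtPinsPhysR`: `blockBd_tpi_of_letter_schemasR_par`, `stepL2_of_letter_schemasR_par`, `stepL2_of_letter_schemas_residualR_par` = the landed `blockBd_tpi_of_letter_schemasR`, `stepL2_of_letter_schemasR`, `stepL2_of_letter_schemas_residualR` VERBATIM with the record's symmetric transporter `parSymY x.toKIdx` replaced by a PARAMETER `parT : ∀ i, SiteParY _ i` (every `GpY ∕ GpPhysY ∕ PcoK ∕ TaLcoK …` letter read at `parT x.toKIdx`; proofs verbatim — the callees were already transporter-generic); at `parT := parSymY` they ARE the originals, at `parT := parKnitY` they serve the knit certificate's Sect.-D network «K3-D» (dag-n06-d g25, `K3D-CENSUS-g25.md`).  Seat `pub-ymgap-dag-n06-d` (g25), 2026-08-30.  The original module text below applies word for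 word otherwise.
#

# BalabanUVNodes ∕ N06 ([B9], `Dag.B9_main`) — THE L² STEP `hstepL2` OF THE STAGE-11 CERTIFICATE AT def-Y's CLASS-PARAMETRIC CARRIER `bg9YR 𝔸 G R₁ R₂`
# (CASCADE-R STEP 3 face of `…N06StepL2AtPinsPhys`: the regularity premises (3.35)–(3.36) are PARAMETERS `R₁ R₂ : RegFamY …`; `bg9Y` and print's class `bg9YP`
# specialise by `rfl`), consumed by the class re-press of dag-n06-d's certificate (ED.39, form (α))

Track A of `YM-PLAN.md` (cell `pub-ymgap`, HUMAN RULING D-0062), node **N06** = [Balaban1985BackgroundPropagators] Thms 3.1–3.15; seat `pub-ymgap-dag-n06-w8` (g3), 2026-08-28.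
WHY.  Edition 35 of the certificate (`…V6EPairNP` :330) consumes this lineage's `N06StepL2AtPinsPhys.stepL2_of_letter_schemas_residual` (g0, p612337), whose displayed
input binders `h31 h46 h49 hBJ hD2L2` and output are typed at MODULE 3's small-cube class `(bg9Y …).Reg335 c35Y α₀ U`.  node00-def-Y g22 RULING-W′ (pub-ymgap INBOX
2026-08-28 11:58Z) + dag-n06-d g12 ANSWER-DEFY-STEP3 (12:09Z): the class of record becomes PRINT's class, re-press form (α) — objects stay over `bg9Y`, ONLY the premises
read `(bg9YP 𝔸 G x).Reg335 c35Y α₀ U`; a COMBINATOR whose inputs are displayed binders must therefore accept the re-pressed premises.  THIS FILE re-types the three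
theorems of `…N06StepL2AtPinsPhys` ONCE at def-Y's class-parametric carrier (`B9BackgroundsKLevelV1R`): premises `(bg9YR (M_N(ℂ)) SU(N) R₁ R₂ x).Reg335 c α₀ U`
(`= R₁ x c α₀ U` by `Iff.rfl`), constant `c` FREE, objects (`𝔬12`, the coordinate models, `U : (bg9Y …).Cfg`) UNCHANGED (`bg9YR_Cfg_eq` rfl); the ONLY class fact the
proofs read — «`U` is `SU(N)`-valued» (`hU.1.1` in the original) — enters as the class axiom `hG : MemOfFam SU(N) R₁` (`memOfFam_regY335` ∕ `memOfFam_regYP335`).  At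
`R₁ := regY335`, `R₂ := regY336`, `c := c35Y` the statements ARE the originals (`bg9Y_eq_bg9YR` rfl); at `R₁ := regYP335`, `R₂ := regYP336` they are the STEP-3 faces
(`bg9YP_eq_bg9YR` rfl).  ★★ `blockBd_tpi_of_letter_schemasR`, ★★ `stepL2_of_letter_schemasR`, ★★ `stepL2_of_letter_schemas_residualR` — proofs VERBATIM those of the
original (Schur + [4] (2.54)∕(2.60)∕(2.61); the transpose facts are tree theorems at a unitary-valued `U`; `isTransposePair_BcoKH_BdcoKH` BY NAME from the original).
HONEST FRAMING.  Kernel bookkeeping; COUNT-NEUTRAL; nothing of [B9] asserted — Theorem 3.1 (3.42)∕(3.46)₄, (3.49), (3.117) at `U ≠ 1` and the residual letter are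
DISPLAYED hypotheses about the genuine operators; N06 NOT discharged; K1 NOT closed.  One finite 𝕋⁴ programme at fixed `ε` — NOT continuum, NOT OS, NOT the mass gap ∕
Clay.  0 `def`, 0 `sorry`.
-/

noncomputable section

namespace Summit.QuantumFields.YangMills.BalabanUVNodes.N06StepL2AtPinsPhysRPar

open Literature.MathematicalPhysics.QuantumFieldTheory.Balaban1983to89
open Literature.MathematicalPhysics.QuantumFieldTheory.Balaban1983to89.Node00 (CfgY GpY GpPhysY parSymY hessY_isSymmTr isAdjTr_comp isAdjTr_of_isSymmTr)
open Literature.MathematicalPhysics.QuantumFieldTheory.Balaban1983to89.Node00.OpsYSectDCoords (DvcoKH DvscoKH RcoK TpicoK T2coK isTransposePair_DvcoKH_DvscoKH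
  isTransposePair_RcoK isTransposePair_coordOpKH_trBasis)
open Literature.MathematicalPhysics.QuantumFieldTheory.Balaban1983to89.B9Thm34Ext (toB6)
open Literature.MathematicalPhysics.QuantumFieldTheory.Balaban1983to89.B11SectG (BlockNorm HasMaj RowSum)
open Literature.MathematicalPhysics.QuantumFieldTheory.Balaban1983to89.B9SectDL2Decay (BlockBd)
open Literature.MathematicalPhysics.QuantumFieldTheory.Balaban1983to89.B9Thm37Glue (IsTransposePair isTransposePair_one)
open Literature.MathematicalPhysics.QuantumFieldTheory.Balaban1983to89.B9Thm312Whole (GeoOK)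
open Literature.MathematicalPhysics.QuantumFieldTheory.Balaban1983to89.B9Thm312WholeL2 (StepL2)
open Literature.MathematicalPhysics.QuantumFieldTheory.Balaban1983to89.B9RWSums343to347Whole (Facts347)
open Literature.MathematicalPhysics.QuantumFieldTheory.Balaban1983to89.B9RWSumsDefinitePins (PinPrims)
open Literature.MathematicalPhysics.QuantumFieldTheory.Balaban1983to89.B9RWSums347DefiniteFaces (exp261 lemma21Pack_geo9Y)
open Literature.MathematicalPhysics.QuantumFieldTheory.Balaban1983to89.B9RowSum261DefiniteFaces (rowConst261 rowConst261_nonneg rowConst261_spec_of_rowSum261)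
open Literature.MathematicalPhysics.QuantumFieldTheory.Balaban1983to89.B9PinMembersKLevelV1 (MemberY geo9Y bg9Y)
open Literature.MathematicalPhysics.QuantumFieldTheory.Balaban1983to89.B9BackgroundsKLevelV1R (RegFamY bg9YR MemOfFam)
open Summit.QuantumFields.YangMills.BalabanUVNodes.N06StepL2AtPinsPhys (isTransposePair_BcoKH_BdcoKH)
open Literature.MathematicalPhysics.QuantumFieldTheory.Balaban1983to89.B9GeoLemma21KLevelV1 (geo9Y_len_pos geo9Y_dist_triangle geo9Y_dist_comm rowSum261_geo9Y)
open Literature.MathematicalPhysics.QuantumFieldTheory.Balaban1983to89.B9GeoNormsKLevelV1 (geo9K_dist_nonneg)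
open Literature.MathematicalPhysics.QuantumFieldTheory.Balaban1983to89.B7Prop2SpecialUnitary (specialUnitaryUnits specialUnitaryUnits_le_unitaryUnits)
open Literature.MathematicalPhysics.QuantumFieldTheory.Balaban1983to89.B9CoReadingCoords (XBK)
open Literature.MathematicalPhysics.QuantumFieldTheory.Balaban1983to89.B9CoReadingCoordsH (XHK)
open Literature.MathematicalPhysics.QuantumFieldTheory.Balaban1983to89.B9CoReadingCoordsS (XSK GcoS)
open Literature.MathematicalPhysics.QuantumFieldTheory.Balaban1983to89.B9CoReadingCoordsTranspose (TrIdx trBasis isTransposePair_GcoS_trBasis)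
open Literature.MathematicalPhysics.QuantumFieldTheory.Balaban1983to89.B9Thm39ReadingCoords (cR39)
open Literature.MathematicalPhysics.QuantumFieldTheory.Balaban1983to89.Node00.OpsYSectDCoords (cR39_trBasis_pos)
open Literature.MathematicalPhysics.QuantumFieldTheory.Balaban1983to89.B9PerturbationSplitAtLetters (TaLcoK TbLcoKH tpicoK_eq_splitL hessGradY divHessY)
open Literature.MathematicalPhysics.QuantumFieldTheory.Balaban1983to89.B9PerturbationMajorantAlgebra (Thm31GpMaj Proj349Maj CurrentMaj)
open Literature.MathematicalPhysics.QuantumFieldTheory.Balaban1983to89.B9PerturbationMajorantsAtLetters (BcoKH BdcoKH PcoK rcoK_eq)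
open Literature.MathematicalPhysics.QuantumFieldTheory.Balaban1983to89.B9PerturbationMajorantsAtLettersPhys (taLcoK_phys_eq_comp tbLcoKH_phys_eq_comp)
open Literature.MathematicalPhysics.QuantumFieldTheory.Balaban1983to89.B9PerturbationL2Algebra (Thm31GpL2Mixed)
open Literature.MathematicalPhysics.QuantumFieldTheory.Balaban1983to89.B9PerturbationL2Letters (constL2 constL2_nonneg blockBd_tpi_of_split stepL2_of_blockBd)
open Literature.MathematicalPhysics.QuantumFieldTheory.Balaban1983to89.B9PerturbationL2Delta2 (D2coK constL2Pi constL2Pi_nonneg blockBd_t2_of_residual t2coK_phys_eq_sandwich)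
open Literature.MathematicalPhysics.QuantumFieldTheory.Balaban1983to89.B9Thm311AdjointPairs (GpY_isSymmTr isAdjTr_gradY_divY)
open Literature.MathematicalPhysics.QuantumFieldTheory.Balaban1983to89.B9Thm311SymmAtRecordV4 (symm0_parSymY)
open scoped Matrix.Norms.L2Operator

variable {N : ℕ} [NeZero N]
variable {d ℓ : ℕ} {hd : 1 ≤ d + 1} {hL : Odd (ℓ + 1) ∧ 1 < ℓ + 1} {b₀ b₁ : ℝ} {Mstar : ℕ}
variable [∀ x : MemberY d ℓ hd hL b₀ b₁ Mstar, Fintype (geo9Y x).Site]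

/-- the kernel domination: `C·t_J·θ·w ≤ t·θ·w` for `C·t_J ≤ t`, `θ, w ≥ 0`. [cite: Balaban1985BackgroundPropagators, (3.131) p.422, bookkeeping] -/
private theorem kernel_dom {C tJ t θ u v e : ℝ} (hCt : C * tJ ≤ t) (hθ : 0 ≤ θ) (hu : 0 ≤ u) (hv : 0 ≤ v) (he : 0 ≤ e) :
    C * (tJ * θ) * u * v * e ≤ t * θ * u * v * e := by
  have h1 : C * (tJ * θ) ≤ t * θ := by rw [← mul_assoc]; exact mul_le_mul_of_nonneg_right hCt hθ
  exact mul_le_mul_of_nonneg_right (mul_le_mul_of_nonneg_right (mul_le_mul_of_nonneg_right h1 hu) hv) he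

/-- a transpose pair scaled on both sides by the same real is a transpose pair (def-Y's private lemma, re-proved). [folklore] -/
private theorem isTransposePair_smul_smul {X Y : Type} [Fintype X] [Fintype Y] {A : (X → ℝ) →ₗ[ℝ] (Y → ℝ)} {B : (Y → ℝ) →ₗ[ℝ] (X → ℝ)}
    (h : IsTransposePair A B) (r : ℝ) : IsTransposePair (r • A) (r • B) := by
  intro u v
  simp only [LinearMap.smul_apply, Pi.smul_apply, smul_eq_mul]
  calc ∑ y, r * A u y * v y = r * ∑ y, A u y * v y := by rw [Finset.mul_sum]; exact Finset.sum_congr rfl fun y _ => by ring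
    _ = r * ∑ x, u x * B v x := by rw [h u v]
    _ = ∑ x, u x * (r * B v x) := by rw [Finset.mul_sum]; exact Finset.sum_congr rfl fun x _ => by ring

/-- ★★ **THE BLOCK-L² BOUND OF Δ′_π AT THE PINS — `StepL2.t`'s SHAPE — FROM THE THREE SUP SCHEMAS, (3.46)₄ AND THE PIN** (module docstring).  Inputs as in
`split_majorants_of_letter_schemas` (`q hq H 𝔬12`, numerics, `h31 h49 hBJ`), plus `h46` ((3.46)₄ at `DvcoKH ∘ GcoS(GpY) ∘ DvscoKH`, block-L²), the pin `hTpico12`, `B₄ δ₄`,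
`r ≤ δ₄`, and ONE displayed constant `t2L ≥ constL2 … (ℓ+1) · t_J`.  Output: `∃ ML`, and for every member with `ML ≤ M_x` in the regime, the block bound of `(𝔬12 x).Tpi U`
with kernel `t2L·(M_xα₀)·(Lʲη)⁻¹·(L^{j′}η)⁻¹·e^{−δ_T d}`. [cite: Balaban1985BackgroundPropagators, (3.130)–(3.131) pp.421–422, (3.120) p.419, Thm 3.1 (3.42) p.397 + (3.46) p.398, (3.49) p.399, (3.117) p.419, p.391; Balaban1984PropagatorsII, (2.54), (2.60)–(2.61) pp.233–234] -/
theorem blockBd_tpi_of_letter_schemasR_par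
    (parT : ∀ i : B6KLevelCensusIndexV1.KIdx d ℓ hd hL b₀ b₁, Node00.SiteParY (Matrix (Fin N) (Fin N) ℂ) i) (q : PinPrims) (hq : q.OK) (H : MemberY d ℓ hd hL b₀ b₁ Mstar → Prop)
    (R₁ R₂ : RegFamY d ℓ hd hL b₀ b₁ Mstar (Matrix (Fin N) (Fin N) ℂ)) (hG : MemOfFam (specialUnitaryUnits (Fin N)) R₁)
    (hsymT : ∀ (x : MemberY d ℓ hd hL b₀ b₁ Mstar) (c α₀ : ℝ) (U : (bg9YR (Matrix (Fin N) (Fin N) ℂ) (specialUnitaryUnits (Fin N)) R₁ R₂ x).Cfg), (bg9YR (Matrix (Fin N) (Fin N) ℂ) (specialUnitaryUnits (Fin N)) R₁ R₂ x).Reg335 c α₀ U → B9Thm311ReadingCoords.IsSymmTr (fun _ => (1 : ℝ)) (Node00.GpY x.toKIdx (parT x.toKIdx) U))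
    (hsymRT : ∀ (x : MemberY d ℓ hd hL b₀ b₁ Mstar) (c α₀ : ℝ) (U : (bg9YR (Matrix (Fin N) (Fin N) ℂ) (specialUnitaryUnits (Fin N)) R₁ R₂ x).Cfg), (bg9YR (Matrix (Fin N) (Fin N) ℂ) (specialUnitaryUnits (Fin N)) R₁ R₂ x).Reg335 c α₀ U → B9Thm311ReadingCoords.IsSymmTr (fun _ => (1 : ℝ)) (Node00.RY x.toKIdx (parT x.toKIdx) (Node00.GpY x.toKIdx (parT x.toKIdx)) U))
    (c : ℝ)
    (𝔬12 : ∀ x : MemberY d ℓ hd hL b₀ b₁ Mstar, B9Thm312Whole.Ops (geo9Y x) (bg9Y (Matrix (Fin N) (Fin N) ℂ) (specialUnitaryUnits (Fin N)) x)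
      (XBK (TrIdx N) x.toKIdx) (XBK (TrIdx N) x.toKIdx) (XHK (TrIdx N) x.toKIdx) (XSK (TrIdx N) x.toKIdx))
    (B₀ δ₀ CP δP tJ δB B₄ δ₄ r δT σS t2L M a : ℝ) (hB₀ : 0 ≤ B₀) (hCP : 0 ≤ CP) (htJ : 0 ≤ tJ) (hB₄ : 0 ≤ B₄) (hσS : 0 < σS) (hM : 0 < M)
    (hr₀ : r ≤ δ₀) (hrP : r ≤ δP) (hrB : r ≤ δB) (hr₄ : r ≤ δ₄) (hδT : 0 ≤ δT) (hδTr : δT + 2 * σS + 3 * (q.αF * ((1 - 2 * q.α) * q.δ₀)) ≤ r)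
    (ht2L : constL2 (cR39 (trBasis N))⁻¹ B₀ CP B₄
      (rowConst261 (geo9Y (d := d) (ℓ := ℓ) (hd := hd) (hL := hL) (b₀ := b₀) (b₁ := b₁) (Mstar := Mstar)) σS) ((ℓ + 1 : ℕ) : ℝ) * tJ ≤ t2L)
    (hTpico12 : ∀ (x : MemberY d ℓ hd hL b₀ b₁ Mstar) (U : (bg9Y (Matrix (Fin N) (Fin N) ℂ) (specialUnitaryUnits (Fin N)) x).Cfg), (𝔬12 x).Tpi U =
      TpicoK x.toKIdx (trBasis N) (bg9Y (Matrix (Fin N) (Fin N) ℂ) (specialUnitaryUnits (Fin N)) x) (fun U => U) (parT x.toKIdx)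
        (GpPhysY x.toKIdx (parT x.toKIdx)) U)
    (h31 : ∀ x : MemberY d ℓ hd hL b₀ b₁ Mstar, M ≤ (geo9Y x).M → ∀ α₀ : ℝ, 0 < α₀ → (geo9Y x).M * α₀ ≤ a →
      ∀ U : (bg9Y (Matrix (Fin N) (Fin N) ℂ) (specialUnitaryUnits (Fin N)) x).Cfg,
        (bg9YR (Matrix (Fin N) (Fin N) ℂ) (specialUnitaryUnits (Fin N)) R₁ R₂ x).Reg335 c α₀ U →
        (bg9YR (Matrix (Fin N) (Fin N) ℂ) (specialUnitaryUnits (Fin N)) R₁ R₂ x).Reg336 c α₀ U →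
          Thm31GpMaj (𝔬12 x).blkW (𝔬12 x).blk
            (GcoS x.toKIdx (trBasis N) (bg9Y (Matrix (Fin N) (Fin N) ℂ) (specialUnitaryUnits (Fin N)) x) (fun U => U) (GpY x.toKIdx (parT x.toKIdx)) U)
            (DvcoKH x.toKIdx (trBasis N) (bg9Y (Matrix (Fin N) (Fin N) ℂ) (specialUnitaryUnits (Fin N)) x) (fun U => U) U)
            (DvscoKH x.toKIdx (trBasis N) (bg9Y (Matrix (Fin N) (Fin N) ℂ) (specialUnitaryUnits (Fin N)) x) (fun U => U) U) 1 (H x) B₀ δ₀)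
    (h46 : ∀ x : MemberY d ℓ hd hL b₀ b₁ Mstar, M ≤ (geo9Y x).M → ∀ α₀ : ℝ, 0 < α₀ → (geo9Y x).M * α₀ ≤ a →
      ∀ U : (bg9Y (Matrix (Fin N) (Fin N) ℂ) (specialUnitaryUnits (Fin N)) x).Cfg,
        (bg9YR (Matrix (Fin N) (Fin N) ℂ) (specialUnitaryUnits (Fin N)) R₁ R₂ x).Reg335 c α₀ U →
        (bg9YR (Matrix (Fin N) (Fin N) ℂ) (specialUnitaryUnits (Fin N)) R₁ R₂ x).Reg336 c α₀ U →
          BlockBd (g := toB6 (geo9Y x) 1 (H x)) (𝔬12 x).blk (𝔬12 x).blk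
            (DvcoKH x.toKIdx (trBasis N) (bg9Y (Matrix (Fin N) (Fin N) ℂ) (specialUnitaryUnits (Fin N)) x) (fun U => U) U ∘ₗ
              GcoS x.toKIdx (trBasis N) (bg9Y (Matrix (Fin N) (Fin N) ℂ) (specialUnitaryUnits (Fin N)) x) (fun U => U) (GpY x.toKIdx (parT x.toKIdx)) U ∘ₗ
              DvscoKH x.toKIdx (trBasis N) (bg9Y (Matrix (Fin N) (Fin N) ℂ) (specialUnitaryUnits (Fin N)) x) (fun U => U) U)
            (fun (y y' : (geo9Y x).Site) => B₄ * Real.exp (-(δ₄ * (geo9Y x).dist y y'))))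
    (h49 : ∀ x : MemberY d ℓ hd hL b₀ b₁ Mstar, M ≤ (geo9Y x).M → ∀ α₀ : ℝ, 0 < α₀ → (geo9Y x).M * α₀ ≤ a →
      ∀ U : (bg9Y (Matrix (Fin N) (Fin N) ℂ) (specialUnitaryUnits (Fin N)) x).Cfg,
        (bg9YR (Matrix (Fin N) (Fin N) ℂ) (specialUnitaryUnits (Fin N)) R₁ R₂ x).Reg335 c α₀ U →
        (bg9YR (Matrix (Fin N) (Fin N) ℂ) (specialUnitaryUnits (Fin N)) R₁ R₂ x).Reg336 c α₀ U →
          Proj349Maj (𝔬12 x).blkW (𝔬12 x).blk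
            (PcoK x.toKIdx (trBasis N) (bg9Y (Matrix (Fin N) (Fin N) ℂ) (specialUnitaryUnits (Fin N)) x) (fun U => U) (parT x.toKIdx)
              (GpY x.toKIdx (parT x.toKIdx)) U)
            (DvcoKH x.toKIdx (trBasis N) (bg9Y (Matrix (Fin N) (Fin N) ℂ) (specialUnitaryUnits (Fin N)) x) (fun U => U) U)
            (DvscoKH x.toKIdx (trBasis N) (bg9Y (Matrix (Fin N) (Fin N) ℂ) (specialUnitaryUnits (Fin N)) x) (fun U => U) U) 1 (H x) CP δP)
    (hBJ : ∀ x : MemberY d ℓ hd hL b₀ b₁ Mstar, M ≤ (geo9Y x).M → ∀ α₀ : ℝ, 0 < α₀ → (geo9Y x).M * α₀ ≤ a →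
      ∀ U : (bg9Y (Matrix (Fin N) (Fin N) ℂ) (specialUnitaryUnits (Fin N)) x).Cfg,
        (bg9YR (Matrix (Fin N) (Fin N) ℂ) (specialUnitaryUnits (Fin N)) R₁ R₂ x).Reg335 c α₀ U →
        (bg9YR (Matrix (Fin N) (Fin N) ℂ) (specialUnitaryUnits (Fin N)) R₁ R₂ x).Reg336 c α₀ U →
          CurrentMaj (𝔬12 x).blkW (𝔬12 x).blk
            (BcoKH x.toKIdx (trBasis N) (bg9Y (Matrix (Fin N) (Fin N) ℂ) (specialUnitaryUnits (Fin N)) x) (fun U => U) U)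
            (BdcoKH x.toKIdx (trBasis N) (bg9Y (Matrix (Fin N) (Fin N) ℂ) (specialUnitaryUnits (Fin N)) x) (fun U => U) U) 1 (H x)
            (tJ * ((geo9Y x).M * α₀)) δB) :
    ∃ ML : ℝ, ∀ x : MemberY d ℓ hd hL b₀ b₁ Mstar, ML ≤ (geo9Y x).M → M ≤ (geo9Y x).M → ∀ α₀ : ℝ, 0 < α₀ → (geo9Y x).M * α₀ ≤ a →
      ∀ U : (bg9Y (Matrix (Fin N) (Fin N) ℂ) (specialUnitaryUnits (Fin N)) x).Cfg,
        (bg9YR (Matrix (Fin N) (Fin N) ℂ) (specialUnitaryUnits (Fin N)) R₁ R₂ x).Reg335 c α₀ U →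
        (bg9YR (Matrix (Fin N) (Fin N) ℂ) (specialUnitaryUnits (Fin N)) R₁ R₂ x).Reg336 c α₀ U →
          BlockBd (g := toB6 (geo9Y x) 1 (H x)) (𝔬12 x).blk (𝔬12 x).blk ((𝔬12 x).Tpi U)
            (fun (y y' : (geo9Y x).Site) => t2L * ((geo9Y x).M * α₀) * ((geo9Y x).len y)⁻¹ * ((geo9Y x).len y')⁻¹ *
              Real.exp (-(δT * (geo9Y x).dist y y'))) := by
  -- member facts at ((1 − 2α)δ₀, α_F) (n06-k) and [4] (2.61) at the rate σ_S with n06-i's DEFINITE constant, above ONE threshold each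
  obtain ⟨ML, -, hfacts, -⟩ :=
    lemma21Pack_geo9Y (d := d) (ℓ := ℓ) (hd := hd) (hL := hL) (b₀ := b₀) (b₁ := b₁) (Mstar := Mstar) H hq.α_pos hq.α_lt
      hq.δ₀_pos hq.αF_pos (by linarith only [hq.αF_lt])
  obtain ⟨MLσ, hrowc⟩ := rowConst261_spec_of_rowSum261
    (rowSum261_geo9Y (d := d) (ℓ := ℓ) (hd := hd) (hL := hL) (b₀ := b₀) (b₁ := b₁) (Mstar := Mstar)) hσS
  have hN : 0 < N := Nat.pos_of_ne_zero (NeZero.ne N)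
  have hc0 : 0 < cR39 (trBasis N) := cR39_trBasis_pos hN
  have hcσ : 0 ≤ rowConst261 (geo9Y (d := d) (ℓ := ℓ) (hd := hd) (hL := hL) (b₀ := b₀) (b₁ := b₁) (Mstar := Mstar)) σS :=
    rowConst261_nonneg _ _
  have hτ : 0 ≤ q.αF * ((1 - 2 * q.α) * q.δ₀) :=
    mul_nonneg hq.αF_pos.le (mul_nonneg (by linarith only [hq.α_lt]) hq.δ₀_pos.le)
  refine ⟨max ML MLσ, fun x hMx hMM α₀ hα ha U hU hU' => ?_⟩
  have hgeo : GeoOK (geo9Y x) := ⟨geo9Y_dist_triangle x, geo9Y_dist_comm x, geo9K_dist_nonneg x.toKIdx, geo9Y_len_pos x⟩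
  have hF := hfacts x ((le_max_left _ _).trans hMx)
  have hrow : RowSum (toB6 (geo9Y x) 1 (H x)) σS
      (rowConst261 (geo9Y (d := d) (ℓ := ℓ) (hd := hd) (hL := hL) (b₀ := b₀) (b₁ := b₁) (Mstar := Mstar)) σS) :=
    fun y => hrowc x ((le_max_right _ _).trans hMx) y
  have hθ : 0 ≤ (geo9Y x).M * α₀ := mul_nonneg (hM.le.trans hMM) hα.le
  -- the transpose facts at the trace basis (tree theorems; `U` is special-unitary by (3.35))
  have hUu : ∀ μ z, ((U μ z : (Matrix (Fin N) (Fin N) ℂ)ˣ) : Matrix (Fin N) (Fin N) ℂ) ∈ unitary (Matrix (Fin N) (Fin N) ℂ) :=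
    fun μ z => specialUnitaryUnits_le_unitaryUnits (hG x c α₀ U hU μ z)
  have hGsym := isTransposePair_GcoS_trBasis x.toKIdx (bg9Y (Matrix (Fin N) (Fin N) ℂ) (specialUnitaryUnits (Fin N)) x) (fun U => U)
    (GpY x.toKIdx (parT x.toKIdx)) U (hsymT x c α₀ U hU)
  have hDv := isTransposePair_DvcoKH_DvscoKH x.toKIdx (bg9Y (Matrix (Fin N) (Fin N) ℂ) (specialUnitaryUnits (Fin N)) x) (fun U => U) U hUu
  have hDG := hGsym.comp hDv
  have hRsym : IsTransposePair (RcoK x.toKIdx (trBasis N) (bg9Y (Matrix (Fin N) (Fin N) ℂ) (specialUnitaryUnits (Fin N)) x) (fun U => U) (parT x.toKIdx) (GpY x.toKIdx (parT x.toKIdx)) U)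
      (RcoK x.toKIdx (trBasis N) (bg9Y (Matrix (Fin N) (Fin N) ℂ) (specialUnitaryUnits (Fin N)) x) (fun U => U) (parT x.toKIdx) (GpY x.toKIdx (parT x.toKIdx)) U) :=
    isTransposePair_smul_smul (B9CoReadingCoordsTranspose.isTransposePair_coordOpK_of_isSymmTr (trBasis N) (B9CoReadingCoordsTranspose.trBasis_repr_eq_trace N) _ (hsymRT x c α₀ U hU)) _
  have hPeq : PcoK x.toKIdx (trBasis N) (bg9Y (Matrix (Fin N) (Fin N) ℂ) (specialUnitaryUnits (Fin N)) x) (fun U => U) (parT x.toKIdx)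
      (GpY x.toKIdx (parT x.toKIdx)) U = 1 - (cR39 (trBasis N)) •
        RcoK x.toKIdx (trBasis N) (bg9Y (Matrix (Fin N) (Fin N) ℂ) (specialUnitaryUnits (Fin N)) x) (fun U => U) (parT x.toKIdx) (GpY x.toKIdx (parT x.toKIdx)) U := by
    rw [rcoK_eq, smul_smul, mul_inv_cancel₀ hc0.ne', one_smul, Module.End.one_eq_id, sub_sub_cancel]
  have hPsym : IsTransposePair
      (PcoK x.toKIdx (trBasis N) (bg9Y (Matrix (Fin N) (Fin N) ℂ) (specialUnitaryUnits (Fin N)) x) (fun U => U) (parT x.toKIdx) (GpY x.toKIdx (parT x.toKIdx)) U)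
      (PcoK x.toKIdx (trBasis N) (bg9Y (Matrix (Fin N) (Fin N) ℂ) (specialUnitaryUnits (Fin N)) x) (fun U => U) (parT x.toKIdx) (GpY x.toKIdx (parT x.toKIdx)) U) := by
    rw [hPeq]; exact isTransposePair_one.sub (isTransposePair_smul_smul hRsym _)
  have hDP := hPsym.comp hDv
  have hBB := isTransposePair_BcoKH_BdcoKH x.toKIdx (bg9Y (Matrix (Fin N) (Fin N) ℂ) (specialUnitaryUnits (Fin N)) x) (fun U => U) U hUu
  -- the split and the two factorizations at the repaired pin
  have hsplit := (hTpico12 x U).trans (tpicoK_eq_splitL x.toKIdx (trBasis N) (bg9Y (Matrix (Fin N) (Fin N) ℂ) (specialUnitaryUnits (Fin N)) x) (fun U => U)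
    (parT x.toKIdx) (GpPhysY x.toKIdx (parT x.toKIdx)) U)
  have hmain := blockBd_tpi_of_split hgeo hF hrow (h31 x hMM α₀ hα ha U hU hU') ⟨h46 x hMM α₀ hα ha U hU hU'⟩ (h49 x hMM α₀ hα ha U hU hU')
    (hBJ x hMM α₀ hα ha U hU hU') hGsym hDG hDP hBB
    (rcoK_eq x.toKIdx (trBasis N) (bg9Y (Matrix (Fin N) (Fin N) ℂ) (specialUnitaryUnits (Fin N)) x) (fun U => U) (parT x.toKIdx) (GpY x.toKIdx (parT x.toKIdx)) U)
    hsplit (taLcoK_phys_eq_comp x.toKIdx (trBasis N) (bg9Y (Matrix (Fin N) (Fin N) ℂ) (specialUnitaryUnits (Fin N)) x) (fun U => U) (parT x.toKIdx) hc0.ne' U)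
    (tbLcoKH_phys_eq_comp x.toKIdx (trBasis N) (bg9Y (Matrix (Fin N) (Fin N) ℂ) (specialUnitaryUnits (Fin N)) x) (fun U => U) (parT x.toKIdx) hc0.ne' U)
    (inv_nonneg.mpr hc0.le) hB₀ hCP hB₄ (mul_nonneg htJ hθ) hcσ hσS.le hτ hr₀ hrP hrB hr₄ hδT hδTr
  refine hmain.mono fun y y' => ?_
  exact kernel_dom ht2L hθ (inv_nonneg.mpr (geo9Y_len_pos x y).le) (inv_nonneg.mpr (geo9Y_len_pos x y').le) (Real.exp_nonneg _)

/-- ★★ **THE DISPLAYED BINDER `hstepL2` FROM THE LETTER SCHEMAS AND ONE RESIDUAL L² LETTER** (module docstring): the inputs of `blockBd_tpi_of_letter_schemas` plus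
`hT2L2` — the block-L² bound `θ₂·(M_xα₀)·(Lʲη)⁻¹(L^{j′}η)⁻¹e^{−δ_T d}` of `(𝔬12 x).T2 U` (Δ⁽²⁾_π = π†Δ⁽²⁾π reads the certificate's FREE residual `(𝔯 x).Δ2`, so this letter stays
displayed — the L² twin of `hta₂ ∕ htb₂`, (3.137) in L²) — give, above ONE threshold `ML`, `StepL2 (𝔬12 x) 1 (H x) ((t2L + θ₂)·(M_xα₀)) δ_T U`: the certificate's `hstepL2`
with `θ2₁₂ := t2L + θ₂`, `δK12 := δ_T`. [cite: Balaban1985BackgroundPropagators, (3.130)–(3.131) pp.421–422, (3.135)–(3.138) pp.422–423, (3.46) p.398, Thm 3.1 (3.42) p.397, (3.49) p.399, (3.117) p.419; Balaban1984PropagatorsII, (2.54), (2.60)–(2.61) pp.233–234] -/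
theorem stepL2_of_letter_schemasR_par
    (parT : ∀ i : B6KLevelCensusIndexV1.KIdx d ℓ hd hL b₀ b₁, Node00.SiteParY (Matrix (Fin N) (Fin N) ℂ) i) (q : PinPrims) (hq : q.OK) (H : MemberY d ℓ hd hL b₀ b₁ Mstar → Prop)
    (R₁ R₂ : RegFamY d ℓ hd hL b₀ b₁ Mstar (Matrix (Fin N) (Fin N) ℂ)) (hG : MemOfFam (specialUnitaryUnits (Fin N)) R₁)
    (hsymT : ∀ (x : MemberY d ℓ hd hL b₀ b₁ Mstar) (c α₀ : ℝ) (U : (bg9YR (Matrix (Fin N) (Fin N) ℂ) (specialUnitaryUnits (Fin N)) R₁ R₂ x).Cfg), (bg9YR (Matrix (Fin N) (Fin N) ℂ) (specialUnitaryUnits (Fin N)) R₁ R₂ x).Reg335 c α₀ U → B9Thm311ReadingCoords.IsSymmTr (fun _ => (1 : ℝ)) (Node00.GpY x.toKIdx (parT x.toKIdx) U))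
    (hsymRT : ∀ (x : MemberY d ℓ hd hL b₀ b₁ Mstar) (c α₀ : ℝ) (U : (bg9YR (Matrix (Fin N) (Fin N) ℂ) (specialUnitaryUnits (Fin N)) R₁ R₂ x).Cfg), (bg9YR (Matrix (Fin N) (Fin N) ℂ) (specialUnitaryUnits (Fin N)) R₁ R₂ x).Reg335 c α₀ U → B9Thm311ReadingCoords.IsSymmTr (fun _ => (1 : ℝ)) (Node00.RY x.toKIdx (parT x.toKIdx) (Node00.GpY x.toKIdx (parT x.toKIdx)) U))
    (c : ℝ)
    (𝔬12 : ∀ x : MemberY d ℓ hd hL b₀ b₁ Mstar, B9Thm312Whole.Ops (geo9Y x) (bg9Y (Matrix (Fin N) (Fin N) ℂ) (specialUnitaryUnits (Fin N)) x)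
      (XBK (TrIdx N) x.toKIdx) (XBK (TrIdx N) x.toKIdx) (XHK (TrIdx N) x.toKIdx) (XSK (TrIdx N) x.toKIdx))
    (B₀ δ₀ CP δP tJ δB B₄ δ₄ r δT σS t2L θ₂ M a : ℝ) (hB₀ : 0 ≤ B₀) (hCP : 0 ≤ CP) (htJ : 0 ≤ tJ) (hB₄ : 0 ≤ B₄) (hθ₂ : 0 ≤ θ₂) (hσS : 0 < σS)
    (hM : 0 < M) (hr₀ : r ≤ δ₀) (hrP : r ≤ δP) (hrB : r ≤ δB) (hr₄ : r ≤ δ₄) (hδT : 0 ≤ δT) (hδTr : δT + 2 * σS + 3 * (q.αF * ((1 - 2 * q.α) * q.δ₀)) ≤ r)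
    (ht2L : constL2 (cR39 (trBasis N))⁻¹ B₀ CP B₄
      (rowConst261 (geo9Y (d := d) (ℓ := ℓ) (hd := hd) (hL := hL) (b₀ := b₀) (b₁ := b₁) (Mstar := Mstar)) σS) ((ℓ + 1 : ℕ) : ℝ) * tJ ≤ t2L)
    (hTpico12 : ∀ (x : MemberY d ℓ hd hL b₀ b₁ Mstar) (U : (bg9Y (Matrix (Fin N) (Fin N) ℂ) (specialUnitaryUnits (Fin N)) x).Cfg), (𝔬12 x).Tpi U =
      TpicoK x.toKIdx (trBasis N) (bg9Y (Matrix (Fin N) (Fin N) ℂ) (specialUnitaryUnits (Fin N)) x) (fun U => U) (parT x.toKIdx)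
        (GpPhysY x.toKIdx (parT x.toKIdx)) U)
    (h31 : ∀ x : MemberY d ℓ hd hL b₀ b₁ Mstar, M ≤ (geo9Y x).M → ∀ α₀ : ℝ, 0 < α₀ → (geo9Y x).M * α₀ ≤ a →
      ∀ U : (bg9Y (Matrix (Fin N) (Fin N) ℂ) (specialUnitaryUnits (Fin N)) x).Cfg,
        (bg9YR (Matrix (Fin N) (Fin N) ℂ) (specialUnitaryUnits (Fin N)) R₁ R₂ x).Reg335 c α₀ U →
        (bg9YR (Matrix (Fin N) (Fin N) ℂ) (specialUnitaryUnits (Fin N)) R₁ R₂ x).Reg336 c α₀ U →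
          Thm31GpMaj (𝔬12 x).blkW (𝔬12 x).blk
            (GcoS x.toKIdx (trBasis N) (bg9Y (Matrix (Fin N) (Fin N) ℂ) (specialUnitaryUnits (Fin N)) x) (fun U => U) (GpY x.toKIdx (parT x.toKIdx)) U)
            (DvcoKH x.toKIdx (trBasis N) (bg9Y (Matrix (Fin N) (Fin N) ℂ) (specialUnitaryUnits (Fin N)) x) (fun U => U) U)
            (DvscoKH x.toKIdx (trBasis N) (bg9Y (Matrix (Fin N) (Fin N) ℂ) (specialUnitaryUnits (Fin N)) x) (fun U => U) U) 1 (H x) B₀ δ₀)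
    (h46 : ∀ x : MemberY d ℓ hd hL b₀ b₁ Mstar, M ≤ (geo9Y x).M → ∀ α₀ : ℝ, 0 < α₀ → (geo9Y x).M * α₀ ≤ a →
      ∀ U : (bg9Y (Matrix (Fin N) (Fin N) ℂ) (specialUnitaryUnits (Fin N)) x).Cfg,
        (bg9YR (Matrix (Fin N) (Fin N) ℂ) (specialUnitaryUnits (Fin N)) R₁ R₂ x).Reg335 c α₀ U →
        (bg9YR (Matrix (Fin N) (Fin N) ℂ) (specialUnitaryUnits (Fin N)) R₁ R₂ x).Reg336 c α₀ U →
          BlockBd (g := toB6 (geo9Y x) 1 (H x)) (𝔬12 x).blk (𝔬12 x).blk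
            (DvcoKH x.toKIdx (trBasis N) (bg9Y (Matrix (Fin N) (Fin N) ℂ) (specialUnitaryUnits (Fin N)) x) (fun U => U) U ∘ₗ
              GcoS x.toKIdx (trBasis N) (bg9Y (Matrix (Fin N) (Fin N) ℂ) (specialUnitaryUnits (Fin N)) x) (fun U => U) (GpY x.toKIdx (parT x.toKIdx)) U ∘ₗ
              DvscoKH x.toKIdx (trBasis N) (bg9Y (Matrix (Fin N) (Fin N) ℂ) (specialUnitaryUnits (Fin N)) x) (fun U => U) U)
            (fun (y y' : (geo9Y x).Site) => B₄ * Real.exp (-(δ₄ * (geo9Y x).dist y y'))))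
    (h49 : ∀ x : MemberY d ℓ hd hL b₀ b₁ Mstar, M ≤ (geo9Y x).M → ∀ α₀ : ℝ, 0 < α₀ → (geo9Y x).M * α₀ ≤ a →
      ∀ U : (bg9Y (Matrix (Fin N) (Fin N) ℂ) (specialUnitaryUnits (Fin N)) x).Cfg,
        (bg9YR (Matrix (Fin N) (Fin N) ℂ) (specialUnitaryUnits (Fin N)) R₁ R₂ x).Reg335 c α₀ U →
        (bg9YR (Matrix (Fin N) (Fin N) ℂ) (specialUnitaryUnits (Fin N)) R₁ R₂ x).Reg336 c α₀ U →
          Proj349Maj (𝔬12 x).blkW (𝔬12 x).blk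
            (PcoK x.toKIdx (trBasis N) (bg9Y (Matrix (Fin N) (Fin N) ℂ) (specialUnitaryUnits (Fin N)) x) (fun U => U) (parT x.toKIdx)
              (GpY x.toKIdx (parT x.toKIdx)) U)
            (DvcoKH x.toKIdx (trBasis N) (bg9Y (Matrix (Fin N) (Fin N) ℂ) (specialUnitaryUnits (Fin N)) x) (fun U => U) U)
            (DvscoKH x.toKIdx (trBasis N) (bg9Y (Matrix (Fin N) (Fin N) ℂ) (specialUnitaryUnits (Fin N)) x) (fun U => U) U) 1 (H x) CP δP)
    (hBJ : ∀ x : MemberY d ℓ hd hL b₀ b₁ Mstar, M ≤ (geo9Y x).M → ∀ α₀ : ℝ, 0 < α₀ → (geo9Y x).M * α₀ ≤ a →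
      ∀ U : (bg9Y (Matrix (Fin N) (Fin N) ℂ) (specialUnitaryUnits (Fin N)) x).Cfg,
        (bg9YR (Matrix (Fin N) (Fin N) ℂ) (specialUnitaryUnits (Fin N)) R₁ R₂ x).Reg335 c α₀ U →
        (bg9YR (Matrix (Fin N) (Fin N) ℂ) (specialUnitaryUnits (Fin N)) R₁ R₂ x).Reg336 c α₀ U →
          CurrentMaj (𝔬12 x).blkW (𝔬12 x).blk
            (BcoKH x.toKIdx (trBasis N) (bg9Y (Matrix (Fin N) (Fin N) ℂ) (specialUnitaryUnits (Fin N)) x) (fun U => U) U)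
            (BdcoKH x.toKIdx (trBasis N) (bg9Y (Matrix (Fin N) (Fin N) ℂ) (specialUnitaryUnits (Fin N)) x) (fun U => U) U) 1 (H x)
            (tJ * ((geo9Y x).M * α₀)) δB)
    (hT2L2 : ∀ x : MemberY d ℓ hd hL b₀ b₁ Mstar, M ≤ (geo9Y x).M → ∀ α₀ : ℝ, 0 < α₀ → (geo9Y x).M * α₀ ≤ a →
      ∀ U : (bg9Y (Matrix (Fin N) (Fin N) ℂ) (specialUnitaryUnits (Fin N)) x).Cfg,
        (bg9YR (Matrix (Fin N) (Fin N) ℂ) (specialUnitaryUnits (Fin N)) R₁ R₂ x).Reg335 c α₀ U →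
        (bg9YR (Matrix (Fin N) (Fin N) ℂ) (specialUnitaryUnits (Fin N)) R₁ R₂ x).Reg336 c α₀ U →
          BlockBd (g := toB6 (geo9Y x) 1 (H x)) (𝔬12 x).blk (𝔬12 x).blk ((𝔬12 x).T2 U)
            (fun (y y' : (geo9Y x).Site) => θ₂ * ((geo9Y x).M * α₀) * ((geo9Y x).len y)⁻¹ * ((geo9Y x).len y')⁻¹ *
              Real.exp (-(δT * (geo9Y x).dist y y')))) :
    ∃ ML : ℝ, ∀ x : MemberY d ℓ hd hL b₀ b₁ Mstar, ML ≤ (geo9Y x).M → M ≤ (geo9Y x).M → ∀ α₀ : ℝ, 0 < α₀ → (geo9Y x).M * α₀ ≤ a →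
      ∀ U : (bg9Y (Matrix (Fin N) (Fin N) ℂ) (specialUnitaryUnits (Fin N)) x).Cfg,
        (bg9YR (Matrix (Fin N) (Fin N) ℂ) (specialUnitaryUnits (Fin N)) R₁ R₂ x).Reg335 c α₀ U →
        (bg9YR (Matrix (Fin N) (Fin N) ℂ) (specialUnitaryUnits (Fin N)) R₁ R₂ x).Reg336 c α₀ U →
          StepL2 (𝔬12 x) 1 (H x) ((t2L + θ₂) * ((geo9Y x).M * α₀)) δT U := by
  obtain ⟨ML, hML⟩ := blockBd_tpi_of_letter_schemasR_par parT (hsymT := hsymT) (hsymRT := hsymRT) q hq H R₁ R₂ hG c 𝔬12 B₀ δ₀ CP δP tJ δB B₄ δ₄ r δT σS t2L M a hB₀ hCP htJ hB₄ hσS hM hr₀ hrP hrB hr₄ hδT hδTr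
    ht2L hTpico12 h31 h46 h49 hBJ
  refine ⟨ML, fun x hMx hMM α₀ hα ha U hU hU' => ?_⟩
  have hgeo : GeoOK (geo9Y x) := ⟨geo9Y_dist_triangle x, geo9Y_dist_comm x, geo9K_dist_nonneg x.toKIdx, geo9Y_len_pos x⟩
  have hθ : 0 ≤ (geo9Y x).M * α₀ := mul_nonneg (hM.le.trans hMM) hα.le
  have h := stepL2_of_blockBd hgeo (mul_nonneg hθ₂ hθ) (hML x hMx hMM α₀ hα ha U hU hU') (hT2L2 x hMM α₀ hα ha U hU hU')
  rwa [← add_mul] at h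

/-- ★★ **v1.1 — THE DISPLAYED BINDER `hstepL2` WITH THE Δ⁽²⁾_π LETTER PUSHED DOWN TO THE RAW RESIDUAL** (module docstring, v1.1): the inputs of
`blockBd_tpi_of_letter_schemas` plus the certificate's pin `hT2co12` of `(𝔬12 x).T2` at a residual family `Δ2`, ONE displayed line `hD2L2` — the block-L² bound
`θ₂·(M_xα₀)·(Lʲη)⁻¹(L^{j′}η)⁻¹e^{−δ₂d}` of `D2coK … (Δ2 x) U` ((3.137) in L² for the FREE residual Δ⁽²⁾ itself) —, `r ≤ δ₂`, the budget `δ_T + 3σ_S + 3·α_F·((1−2α)δ₀) ≤ r`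
and a displayed constant `t2P ≥ θ₂·constL2Pi (cR39 (trBasis N))⁻¹ B₀ C_P B₄ (rowConst261 geo9Y σ_S) (ℓ+1)` give, above ONE threshold, `StepL2 (𝔬12 x) 1 (H x) ((t2L + t2P)·(M_xα₀)) δ_T U`.
[cite: Balaban1985BackgroundPropagators, (3.130)–(3.131) pp.421–422, (3.135) p.422, (3.137)–(3.138) p.423, (3.46) p.398, Thm 3.1 (3.42) p.397, (3.49) p.399, (3.117) p.419; Balaban1984PropagatorsII, (2.54), (2.60)–(2.61) pp.233–234] -/
theorem stepL2_of_letter_schemas_residualR_par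
    (parT : ∀ i : B6KLevelCensusIndexV1.KIdx d ℓ hd hL b₀ b₁, Node00.SiteParY (Matrix (Fin N) (Fin N) ℂ) i) (q : PinPrims) (hq : q.OK) (H : MemberY d ℓ hd hL b₀ b₁ Mstar → Prop)
    (R₁ R₂ : RegFamY d ℓ hd hL b₀ b₁ Mstar (Matrix (Fin N) (Fin N) ℂ)) (hG : MemOfFam (specialUnitaryUnits (Fin N)) R₁)
    (hsymT : ∀ (x : MemberY d ℓ hd hL b₀ b₁ Mstar) (c α₀ : ℝ) (U : (bg9YR (Matrix (Fin N) (Fin N) ℂ) (specialUnitaryUnits (Fin N)) R₁ R₂ x).Cfg), (bg9YR (Matrix (Fin N) (Fin N) ℂ) (specialUnitaryUnits (Fin N)) R₁ R₂ x).Reg335 c α₀ U → B9Thm311ReadingCoords.IsSymmTr (fun _ => (1 : ℝ)) (Node00.GpY x.toKIdx (parT x.toKIdx) U))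
    (hsymRT : ∀ (x : MemberY d ℓ hd hL b₀ b₁ Mstar) (c α₀ : ℝ) (U : (bg9YR (Matrix (Fin N) (Fin N) ℂ) (specialUnitaryUnits (Fin N)) R₁ R₂ x).Cfg), (bg9YR (Matrix (Fin N) (Fin N) ℂ) (specialUnitaryUnits (Fin N)) R₁ R₂ x).Reg335 c α₀ U → B9Thm311ReadingCoords.IsSymmTr (fun _ => (1 : ℝ)) (Node00.RY x.toKIdx (parT x.toKIdx) (Node00.GpY x.toKIdx (parT x.toKIdx)) U))
    (c : ℝ)
    (𝔬12 : ∀ x : MemberY d ℓ hd hL b₀ b₁ Mstar, B9Thm312Whole.Ops (geo9Y x) (bg9Y (Matrix (Fin N) (Fin N) ℂ) (specialUnitaryUnits (Fin N)) x)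
      (XBK (TrIdx N) x.toKIdx) (XBK (TrIdx N) x.toKIdx) (XHK (TrIdx N) x.toKIdx) (XSK (TrIdx N) x.toKIdx))
    (Δ2 : ∀ x : MemberY d ℓ hd hL b₀ b₁ Mstar, Node00.BondOpY (Matrix (Fin N) (Fin N) ℂ) x.toKIdx)
    (B₀ δ₀ CP δP tJ δB B₄ δ₄ r δT σS t2L θ₂ δ₂ t2P M a : ℝ) (hB₀ : 0 ≤ B₀) (hCP : 0 ≤ CP) (htJ : 0 ≤ tJ) (hB₄ : 0 ≤ B₄) (hθ₂ : 0 ≤ θ₂)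
    (hσS : 0 < σS) (hM : 0 < M) (hr₀ : r ≤ δ₀) (hrP : r ≤ δP) (hrB : r ≤ δB) (hr₄ : r ≤ δ₄) (hr₂ : r ≤ δ₂) (hδT : 0 ≤ δT)
    (hδTr : δT + 3 * σS + 3 * (q.αF * ((1 - 2 * q.α) * q.δ₀)) ≤ r)
    (ht2L : constL2 (cR39 (trBasis N))⁻¹ B₀ CP B₄
      (rowConst261 (geo9Y (d := d) (ℓ := ℓ) (hd := hd) (hL := hL) (b₀ := b₀) (b₁ := b₁) (Mstar := Mstar)) σS) ((ℓ + 1 : ℕ) : ℝ) * tJ ≤ t2L)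
    (ht2P : θ₂ * constL2Pi (cR39 (trBasis N))⁻¹ B₀ CP B₄
      (rowConst261 (geo9Y (d := d) (ℓ := ℓ) (hd := hd) (hL := hL) (b₀ := b₀) (b₁ := b₁) (Mstar := Mstar)) σS) ((ℓ + 1 : ℕ) : ℝ) ≤ t2P)
    (hTpico12 : ∀ (x : MemberY d ℓ hd hL b₀ b₁ Mstar) (U : (bg9Y (Matrix (Fin N) (Fin N) ℂ) (specialUnitaryUnits (Fin N)) x).Cfg), (𝔬12 x).Tpi U =
      TpicoK x.toKIdx (trBasis N) (bg9Y (Matrix (Fin N) (Fin N) ℂ) (specialUnitaryUnits (Fin N)) x) (fun U => U) (parT x.toKIdx)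
        (GpPhysY x.toKIdx (parT x.toKIdx)) U)
    (hT2co12 : ∀ (x : MemberY d ℓ hd hL b₀ b₁ Mstar) (U : (bg9Y (Matrix (Fin N) (Fin N) ℂ) (specialUnitaryUnits (Fin N)) x).Cfg), (𝔬12 x).T2 U =
      T2coK x.toKIdx (trBasis N) (bg9Y (Matrix (Fin N) (Fin N) ℂ) (specialUnitaryUnits (Fin N)) x) (fun U => U) (parT x.toKIdx)
        (GpPhysY x.toKIdx (parT x.toKIdx)) (Δ2 x) U)
    (h31 : ∀ x : MemberY d ℓ hd hL b₀ b₁ Mstar, M ≤ (geo9Y x).M → ∀ α₀ : ℝ, 0 < α₀ → (geo9Y x).M * α₀ ≤ a →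
      ∀ U : (bg9Y (Matrix (Fin N) (Fin N) ℂ) (specialUnitaryUnits (Fin N)) x).Cfg, (bg9YR (Matrix (Fin N) (Fin N) ℂ) (specialUnitaryUnits (Fin N)) R₁ R₂ x).Reg335 c α₀ U →
        (bg9YR (Matrix (Fin N) (Fin N) ℂ) (specialUnitaryUnits (Fin N)) R₁ R₂ x).Reg336 c α₀ U →
          Thm31GpMaj (𝔬12 x).blkW (𝔬12 x).blk
            (GcoS x.toKIdx (trBasis N) (bg9Y (Matrix (Fin N) (Fin N) ℂ) (specialUnitaryUnits (Fin N)) x) (fun U => U) (GpY x.toKIdx (parT x.toKIdx)) U)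
            (DvcoKH x.toKIdx (trBasis N) (bg9Y (Matrix (Fin N) (Fin N) ℂ) (specialUnitaryUnits (Fin N)) x) (fun U => U) U)
            (DvscoKH x.toKIdx (trBasis N) (bg9Y (Matrix (Fin N) (Fin N) ℂ) (specialUnitaryUnits (Fin N)) x) (fun U => U) U) 1 (H x) B₀ δ₀)
    (h46 : ∀ x : MemberY d ℓ hd hL b₀ b₁ Mstar, M ≤ (geo9Y x).M → ∀ α₀ : ℝ, 0 < α₀ → (geo9Y x).M * α₀ ≤ a →
      ∀ U : (bg9Y (Matrix (Fin N) (Fin N) ℂ) (specialUnitaryUnits (Fin N)) x).Cfg, (bg9YR (Matrix (Fin N) (Fin N) ℂ) (specialUnitaryUnits (Fin N)) R₁ R₂ x).Reg335 c α₀ U →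
        (bg9YR (Matrix (Fin N) (Fin N) ℂ) (specialUnitaryUnits (Fin N)) R₁ R₂ x).Reg336 c α₀ U →
          BlockBd (g := toB6 (geo9Y x) 1 (H x)) (𝔬12 x).blk (𝔬12 x).blk
            (DvcoKH x.toKIdx (trBasis N) (bg9Y (Matrix (Fin N) (Fin N) ℂ) (specialUnitaryUnits (Fin N)) x) (fun U => U) U ∘ₗ
              GcoS x.toKIdx (trBasis N) (bg9Y (Matrix (Fin N) (Fin N) ℂ) (specialUnitaryUnits (Fin N)) x) (fun U => U) (GpY x.toKIdx (parT x.toKIdx)) U ∘ₗ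
              DvscoKH x.toKIdx (trBasis N) (bg9Y (Matrix (Fin N) (Fin N) ℂ) (specialUnitaryUnits (Fin N)) x) (fun U => U) U)
            (fun (y y' : (geo9Y x).Site) => B₄ * Real.exp (-(δ₄ * (geo9Y x).dist y y'))))
    (h49 : ∀ x : MemberY d ℓ hd hL b₀ b₁ Mstar, M ≤ (geo9Y x).M → ∀ α₀ : ℝ, 0 < α₀ → (geo9Y x).M * α₀ ≤ a →
      ∀ U : (bg9Y (Matrix (Fin N) (Fin N) ℂ) (specialUnitaryUnits (Fin N)) x).Cfg, (bg9YR (Matrix (Fin N) (Fin N) ℂ) (specialUnitaryUnits (Fin N)) R₁ R₂ x).Reg335 c α₀ U →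
        (bg9YR (Matrix (Fin N) (Fin N) ℂ) (specialUnitaryUnits (Fin N)) R₁ R₂ x).Reg336 c α₀ U →
          Proj349Maj (𝔬12 x).blkW (𝔬12 x).blk
            (PcoK x.toKIdx (trBasis N) (bg9Y (Matrix (Fin N) (Fin N) ℂ) (specialUnitaryUnits (Fin N)) x) (fun U => U) (parT x.toKIdx)
              (GpY x.toKIdx (parT x.toKIdx)) U)
            (DvcoKH x.toKIdx (trBasis N) (bg9Y (Matrix (Fin N) (Fin N) ℂ) (specialUnitaryUnits (Fin N)) x) (fun U => U) U)
            (DvscoKH x.toKIdx (trBasis N) (bg9Y (Matrix (Fin N) (Fin N) ℂ) (specialUnitaryUnits (Fin N)) x) (fun U => U) U) 1 (H x) CP δP)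
    (hBJ : ∀ x : MemberY d ℓ hd hL b₀ b₁ Mstar, M ≤ (geo9Y x).M → ∀ α₀ : ℝ, 0 < α₀ → (geo9Y x).M * α₀ ≤ a →
      ∀ U : (bg9Y (Matrix (Fin N) (Fin N) ℂ) (specialUnitaryUnits (Fin N)) x).Cfg, (bg9YR (Matrix (Fin N) (Fin N) ℂ) (specialUnitaryUnits (Fin N)) R₁ R₂ x).Reg335 c α₀ U →
        (bg9YR (Matrix (Fin N) (Fin N) ℂ) (specialUnitaryUnits (Fin N)) R₁ R₂ x).Reg336 c α₀ U →
          CurrentMaj (𝔬12 x).blkW (𝔬12 x).blk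
            (BcoKH x.toKIdx (trBasis N) (bg9Y (Matrix (Fin N) (Fin N) ℂ) (specialUnitaryUnits (Fin N)) x) (fun U => U) U)
            (BdcoKH x.toKIdx (trBasis N) (bg9Y (Matrix (Fin N) (Fin N) ℂ) (specialUnitaryUnits (Fin N)) x) (fun U => U) U) 1 (H x)
            (tJ * ((geo9Y x).M * α₀)) δB)
    (hD2L2 : ∀ x : MemberY d ℓ hd hL b₀ b₁ Mstar, M ≤ (geo9Y x).M → ∀ α₀ : ℝ, 0 < α₀ → (geo9Y x).M * α₀ ≤ a →
      ∀ U : (bg9Y (Matrix (Fin N) (Fin N) ℂ) (specialUnitaryUnits (Fin N)) x).Cfg, (bg9YR (Matrix (Fin N) (Fin N) ℂ) (specialUnitaryUnits (Fin N)) R₁ R₂ x).Reg335 c α₀ U →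
        (bg9YR (Matrix (Fin N) (Fin N) ℂ) (specialUnitaryUnits (Fin N)) R₁ R₂ x).Reg336 c α₀ U →
          BlockBd (g := toB6 (geo9Y x) 1 (H x)) (𝔬12 x).blk (𝔬12 x).blk
            (D2coK x.toKIdx (trBasis N) (bg9Y (Matrix (Fin N) (Fin N) ℂ) (specialUnitaryUnits (Fin N)) x) (fun U => U) (Δ2 x) U)
            (fun (y y' : (geo9Y x).Site) => θ₂ * ((geo9Y x).M * α₀) * ((geo9Y x).len y)⁻¹ * ((geo9Y x).len y')⁻¹ *
              Real.exp (-(δ₂ * (geo9Y x).dist y y')))) :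
    ∃ ML : ℝ, ∀ x : MemberY d ℓ hd hL b₀ b₁ Mstar, ML ≤ (geo9Y x).M → M ≤ (geo9Y x).M → ∀ α₀ : ℝ, 0 < α₀ → (geo9Y x).M * α₀ ≤ a →
      ∀ U : (bg9Y (Matrix (Fin N) (Fin N) ℂ) (specialUnitaryUnits (Fin N)) x).Cfg, (bg9YR (Matrix (Fin N) (Fin N) ℂ) (specialUnitaryUnits (Fin N)) R₁ R₂ x).Reg335 c α₀ U →
        (bg9YR (Matrix (Fin N) (Fin N) ℂ) (specialUnitaryUnits (Fin N)) R₁ R₂ x).Reg336 c α₀ U →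
          StepL2 (𝔬12 x) 1 (H x) ((t2L + t2P) * ((geo9Y x).M * α₀)) δT U := by
  have hδTr2 : δT + 2 * σS + 3 * (q.αF * ((1 - 2 * q.α) * q.δ₀)) ≤ r := by linarith
  obtain ⟨ML1, hML1⟩ := blockBd_tpi_of_letter_schemasR_par parT (hsymT := hsymT) (hsymRT := hsymRT) q hq H R₁ R₂ hG c 𝔬12 B₀ δ₀ CP δP tJ δB B₄ δ₄ r δT σS t2L M a hB₀ hCP htJ hB₄ hσS hM hr₀ hrP hrB hr₄ hδT
    hδTr2 ht2L hTpico12 h31 h46 h49 hBJ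
  obtain ⟨ML2, -, hfacts, -⟩ :=
    lemma21Pack_geo9Y (d := d) (ℓ := ℓ) (hd := hd) (hL := hL) (b₀ := b₀) (b₁ := b₁) (Mstar := Mstar) H hq.α_pos hq.α_lt
      hq.δ₀_pos hq.αF_pos (by linarith only [hq.αF_lt])
  obtain ⟨MLσ, hrowc⟩ := rowConst261_spec_of_rowSum261
    (rowSum261_geo9Y (d := d) (ℓ := ℓ) (hd := hd) (hL := hL) (b₀ := b₀) (b₁ := b₁) (Mstar := Mstar)) hσS
  have hc0 : 0 < cR39 (trBasis N) := cR39_trBasis_pos (Nat.pos_of_ne_zero (NeZero.ne N))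
  have hcσ : 0 ≤ rowConst261 (geo9Y (d := d) (ℓ := ℓ) (hd := hd) (hL := hL) (b₀ := b₀) (b₁ := b₁) (Mstar := Mstar)) σS := rowConst261_nonneg _ _
  have hτ : 0 ≤ q.αF * ((1 - 2 * q.α) * q.δ₀) := mul_nonneg hq.αF_pos.le (mul_nonneg (by linarith only [hq.α_lt]) hq.δ₀_pos.le)
  refine ⟨max ML1 (max ML2 MLσ), fun x hMx hMM α₀ hα ha U hU hU' => ?_⟩
  have hgeo : GeoOK (geo9Y x) := ⟨geo9Y_dist_triangle x, geo9Y_dist_comm x, geo9K_dist_nonneg x.toKIdx, geo9Y_len_pos x⟩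
  have hF := hfacts x ((le_max_left _ _).trans ((le_max_right _ _).trans hMx))
  have hrow : RowSum (toB6 (geo9Y x) 1 (H x)) σS
      (rowConst261 (geo9Y (d := d) (ℓ := ℓ) (hd := hd) (hL := hL) (b₀ := b₀) (b₁ := b₁) (Mstar := Mstar)) σS) :=
    fun y => hrowc x ((le_max_right _ _).trans ((le_max_right _ _).trans hMx)) y
  have hθ : 0 ≤ (geo9Y x).M * α₀ := mul_nonneg (hM.le.trans hMM) hα.le
  have hUu : ∀ μ z, ((U μ z : (Matrix (Fin N) (Fin N) ℂ)ˣ) : Matrix (Fin N) (Fin N) ℂ) ∈ unitary (Matrix (Fin N) (Fin N) ℂ) :=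
    fun μ z => specialUnitaryUnits_le_unitaryUnits (hG x c α₀ U hU μ z)
  have hGsym := isTransposePair_GcoS_trBasis x.toKIdx (bg9Y (Matrix (Fin N) (Fin N) ℂ) (specialUnitaryUnits (Fin N)) x) (fun U => U)
    (GpY x.toKIdx (parT x.toKIdx)) U (hsymT x c α₀ U hU)
  have hDv := isTransposePair_DvcoKH_DvscoKH x.toKIdx (bg9Y (Matrix (Fin N) (Fin N) ℂ) (specialUnitaryUnits (Fin N)) x) (fun U => U) U hUu
  have hRsym : IsTransposePair (RcoK x.toKIdx (trBasis N) (bg9Y (Matrix (Fin N) (Fin N) ℂ) (specialUnitaryUnits (Fin N)) x) (fun U => U) (parT x.toKIdx) (GpY x.toKIdx (parT x.toKIdx)) U)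
      (RcoK x.toKIdx (trBasis N) (bg9Y (Matrix (Fin N) (Fin N) ℂ) (specialUnitaryUnits (Fin N)) x) (fun U => U) (parT x.toKIdx) (GpY x.toKIdx (parT x.toKIdx)) U) :=
    isTransposePair_smul_smul (B9CoReadingCoordsTranspose.isTransposePair_coordOpK_of_isSymmTr (trBasis N) (B9CoReadingCoordsTranspose.trBasis_repr_eq_trace N) _ (hsymRT x c α₀ U hU)) _
  have hPeq : PcoK x.toKIdx (trBasis N) (bg9Y (Matrix (Fin N) (Fin N) ℂ) (specialUnitaryUnits (Fin N)) x) (fun U => U) (parT x.toKIdx)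
      (GpY x.toKIdx (parT x.toKIdx)) U = 1 - (cR39 (trBasis N)) •
        RcoK x.toKIdx (trBasis N) (bg9Y (Matrix (Fin N) (Fin N) ℂ) (specialUnitaryUnits (Fin N)) x) (fun U => U) (parT x.toKIdx) (GpY x.toKIdx (parT x.toKIdx)) U := by
    rw [rcoK_eq, smul_smul, mul_inv_cancel₀ hc0.ne', one_smul, Module.End.one_eq_id, sub_sub_cancel]
  have hPsym : IsTransposePair
      (PcoK x.toKIdx (trBasis N) (bg9Y (Matrix (Fin N) (Fin N) ℂ) (specialUnitaryUnits (Fin N)) x) (fun U => U) (parT x.toKIdx) (GpY x.toKIdx (parT x.toKIdx)) U)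
      (PcoK x.toKIdx (trBasis N) (bg9Y (Matrix (Fin N) (Fin N) ℂ) (specialUnitaryUnits (Fin N)) x) (fun U => U) (parT x.toKIdx) (GpY x.toKIdx (parT x.toKIdx)) U) := by
    rw [hPeq]; exact isTransposePair_one.sub (isTransposePair_smul_smul hRsym _)
  have hT2 := (hT2co12 x U).trans (t2coK_phys_eq_sandwich x.toKIdx (trBasis N) (bg9Y (Matrix (Fin N) (Fin N) ℂ) (specialUnitaryUnits (Fin N)) x) (fun U => U)
    (parT x.toKIdx) (Δ2 x) hc0.ne' U)
  have ht2 := blockBd_t2_of_residual hgeo hF hrow (h31 x hMM α₀ hα ha U hU hU') ⟨h46 x hMM α₀ hα ha U hU hU'⟩ (h49 x hMM α₀ hα ha U hU hU')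
    (hGsym.comp hDv) (hPsym.comp hDv)
    (rcoK_eq x.toKIdx (trBasis N) (bg9Y (Matrix (Fin N) (Fin N) ℂ) (specialUnitaryUnits (Fin N)) x) (fun U => U) (parT x.toKIdx) (GpY x.toKIdx (parT x.toKIdx)) U)
    (hD2L2 x hMM α₀ hα ha U hU hU') hT2 (inv_nonneg.mpr hc0.le) hB₀ hCP hB₄ (mul_nonneg hθ₂ hθ) hcσ hσS.le hτ hr₀ hrP hr₄ hr₂ hδT hδTr
  have ht2' : BlockBd (g := toB6 (geo9Y x) 1 (H x)) (𝔬12 x).blk (𝔬12 x).blk ((𝔬12 x).T2 U)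
      (fun (y y' : (geo9Y x).Site) => t2P * ((geo9Y x).M * α₀) * ((geo9Y x).len y)⁻¹ * ((geo9Y x).len y')⁻¹ * Real.exp (-(δT * (geo9Y x).dist y y'))) := by
    refine ht2.mono fun y y' => ?_
    have hK : θ₂ * ((geo9Y x).M * α₀) * constL2Pi (cR39 (trBasis N))⁻¹ B₀ CP B₄
        (rowConst261 (geo9Y (d := d) (ℓ := ℓ) (hd := hd) (hL := hL) (b₀ := b₀) (b₁ := b₁) (Mstar := Mstar)) σS) (geo9Y x).L ≤ t2P * ((geo9Y x).M * α₀) := by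
      calc θ₂ * ((geo9Y x).M * α₀) * constL2Pi (cR39 (trBasis N))⁻¹ B₀ CP B₄ (rowConst261 geo9Y σS) (geo9Y x).L
          = θ₂ * constL2Pi (cR39 (trBasis N))⁻¹ B₀ CP B₄ (rowConst261 geo9Y σS) (geo9Y x).L * ((geo9Y x).M * α₀) := by ring
        _ ≤ t2P * ((geo9Y x).M * α₀) := mul_le_mul_of_nonneg_right ht2P hθ
    exact mul_le_mul_of_nonneg_right (mul_le_mul_of_nonneg_right (mul_le_mul_of_nonneg_right hK (inv_nonneg.mpr (geo9Y_len_pos x y).le))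
      (inv_nonneg.mpr (geo9Y_len_pos x y').le)) (Real.exp_nonneg _)
  have h := stepL2_of_blockBd hgeo (mul_nonneg ((mul_nonneg hθ₂ (constL2Pi_nonneg _ _ _ _ _ _)).trans ht2P) hθ) (hML1 x ((le_max_left _ _).trans hMx) hMM α₀ hα ha U hU hU') ht2'
  rwa [← add_mul] at h

end Summit.QuantumFields.YangMills.BalabanUVNodes.N06StepL2AtPinsPhysRPar

end
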